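import Mathlib
import HarnessLib
import Literature.MathematicalPhysics.QuantumLattice.GaugeGroups
import Summits.Ventures.LatticeQCDFlow.Exactness.CompactHaar
import Summits.Ventures.LatticeQCDFlow.Exactness.Overrelaxation
import Summits.Ventures.LatticeQCDFlow.Exactness.CabibboMarinariKernel
import Summits.Ventures.LatticeQCDFlow.Exactness.CabibboMarinariQuat

/-!
# The Cabibbo–Marinari over-relaxation hit of an SU(N) link is an exact (Haar-preserving, involutive, action-conserving) move

HONEST FRAMING: exact (Metropolis-corrected) sampling algorithms for lattice gauge theory;
figures of merit are autocorrelation/cost numbers at stated couplings and volumes; no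
continuum-physics claim.

Venture `LatticeQCDFlow` (cell pub-lqcd), topic `Exactness`, FANOUT row 9 (eng-latcore; the
engine's `updates.sweep(f, β, 'or')` for `SU(N ≥ 3)`, `csrc/latcore_template.c`: per SU(2)
subgroup `(i, j)` read the block of `W = U R`, take its quaternionic part `k ŝ`, and if `k > 0`
left-multiply the link by the embedded `(ŝ†)²` — the `N = 2` reflection `A ↦ ŝ† A† ŝ†` at `A = 1`).
NEW WORK of the cell over Mathlib, `CabibboMarinari*.lean` (incl. `CabibboMarinariQuat.lean`),
`SU2StapleSum.lean`, `Overrelaxation.lean` and `CompactHaar.lean`; nothing is cited as a fact.  Printed counterparts, named only: Creutz 1987 /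
Brown–Woch 1987 (over-relaxation), Cabibbo–Marinari 1982.

`WilsonOverrelaxation.lean` + `SU2StapleSum.lean` type the `N = 2` reflection; the `N ≥ 3` lift was
listed as not filed.  The obstacle is measure-theoretic: the move acts inside the cosets `φ(SU(2)) g`
of `SU(n)`, which have no measurable section.  As in `SubgroupHeatBath.lean` the group structure
replaces the section: Haar measure on `SU(n)` is preserved because, averaged over a coset with the
Haar probability of `SU(2)`, the move is the reflection `h ↦ s h⁻¹ s` of `SU(2)` (which preserves its
Haar measure, `CompactHaar.lean`), and left translations preserve Haar on `SU(n)` (Fubini).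

## Content (`e : n ≃ Fin 2 ⊕ m` a subgroup frame, `R` the staple sum, `c = β/N`)

* (algebra in `CabibboMarinariQuat.lean`: the unit part `quatUnit Q = ŝ`, its SU(2) membership,
  polar form and equivariance `ŝ(A Q) = A ŝ(Q)`, and `quatDouble (A w) = A · quatDouble w`.)
* `cmQuat e R g` — the quaternionic part of the `e`-block of `g R`; `cmQuat_blockEmb_mul`;
  `cmUnit e R g : SU(2)` (measurable); `cmOR e R g = φ((ŝ†)²) · g` — **the engine's OR hit**.
* `cmOR_blockEmb_mul` — on a coset: `cmOR (φ(A) g) = φ(s A⁻¹ s) g` with `s = ŝ(g)†` (`= φ(A) g` on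
  the null cosets `k = 0`); **`cmOR_involutive`**; **`lintegral_cmOR` / `measurePreserving_cmOR`**
  (Haar on `SU(n)` is preserved); **`linkWeight_cmOR`** (the one-link action is conserved);
* **`cmOR_isReversible` / `cmOR_invariant`** — the deterministic OR hit is reversible for, and leaves
  invariant, the one-link Wilson law `e^{c Re tr (g R)} · Haar_SU(n)` (`microcanonical_isReversible`).

Not here: ergodicity (OR alone conserves the action; the engine interleaves heat-bath hits), the
sweep over subgroups / links (`InvariantComposition.lean`), floating point.
-/

namespace Summit.Ventures.LatticeQCDFlow.Exactness

open Matrix MeasureTheory ProbabilityTheory ComplexConjugate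
open scoped ENNReal

/-! ## §1 The quaternion of a link in a frame, and the OR move -/

section OR

variable {n m : Type*} [Fintype n] [DecidableEq n] [Fintype m] [DecidableEq m]
  (e : n ≃ Fin 2 ⊕ m) (R : Matrix n n ℂ)

omit [DecidableEq n] in
/-- The `e`-block of a product with an embedded matrix: `(φ(A) W)₁₁ = A W₁₁`. -/
theorem toBlocks₁₁_blockEmb_mul (A : Matrix (Fin 2) (Fin 2) ℂ) (W : Matrix n n ℂ) :
    ((blockEmb e A * W).submatrix e.symm e.symm).toBlocks₁₁
      = A * (W.submatrix e.symm e.symm).toBlocks₁₁ := by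
  set W' := W.submatrix e.symm e.symm with hW'
  have hW : W = W'.submatrix e e := by
    rw [hW', Matrix.submatrix_submatrix]; simp
  conv_lhs => rw [hW, blockEmb, Matrix.submatrix_mul_equiv, Matrix.submatrix_submatrix]
  simp only [Equiv.self_comp_symm, Matrix.submatrix_id_id]
  conv_lhs => rw [← Matrix.fromBlocks_toBlocks W', Matrix.fromBlocks_multiply]
  simp

/-- The quaternionic part (doubled) of the `e`-block of `g R`: `Q(g) = quatDouble (gR)₁₁ = k ŝ`. -/
noncomputable def cmQuat (g : Matrix.specialUnitaryGroup n ℂ) : Matrix (Fin 2) (Fin 2) ℂ :=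
  quatDouble (((g : Matrix n n ℂ) * R).submatrix e.symm e.symm).toBlocks₁₁

omit [Fintype m] [DecidableEq m] in
/-- `Q(g)` is a quaternion. -/
theorem isQuat_cmQuat (g : Matrix.specialUnitaryGroup n ℂ) : IsQuat (cmQuat e R g) :=
  isQuat_quatDouble _

/-- `Q(φ(A) g) = A · Q(g)`. -/
theorem cmQuat_blockEmb_mul (A : Matrix.specialUnitaryGroup (Fin 2) ℂ)
    (g : Matrix.specialUnitaryGroup n ℂ) :
    cmQuat e R (blockEmbSU e A * g) = (A : Matrix (Fin 2) (Fin 2) ℂ) * cmQuat e R g := by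
  unfold cmQuat
  rw [Submonoid.coe_mul, coe_blockEmbSU, Matrix.mul_assoc, toBlocks₁₁_blockEmb_mul,
    quatDouble_quat_mul (IsQuat.of_mem_specialUnitaryGroup A.2)]

/-- `quatDouble` is continuous. -/
theorem continuous_quatDouble : Continuous (quatDouble : Matrix (Fin 2) (Fin 2) ℂ → _) := by
  refine continuous_matrix fun i j => ?_
  fin_cases i <;> fin_cases j <;>
    simp only [quatDouble, quatOf, Matrix.of_apply, Matrix.cons_val', Matrix.empty_val',
      Matrix.cons_val_fin_one] <;> fun_prop

omit [Fintype m] [DecidableEq m] in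
/-- `Q` is continuous in the link. -/
theorem continuous_cmQuat : Continuous (cmQuat e R) := by
  unfold cmQuat
  refine continuous_quatDouble.comp ?_
  exact Continuous.matrix_submatrix ((continuous_subtype_val.matrix_mul continuous_const).matrix_submatrix
    _ _) _ _

/-- The squared norm of a `2 × 2` matrix (as used by `IsQuat`) is continuous. -/
theorem continuous_normSq : Continuous (IsQuat.normSq : Matrix (Fin 2) (Fin 2) ℂ → ℝ) := by
  unfold IsQuat.normSq
  fun_prop

/-- The unit quaternion `ŝ(g) ∈ SU(2)` of the block. -/
noncomputable def cmUnit (g : Matrix.specialUnitaryGroup n ℂ) : Matrix.specialUnitaryGroup (Fin 2) ℂ :=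
  ⟨quatUnit (cmQuat e R g), quatUnit_mem (isQuat_cmQuat e R g)⟩

omit [Fintype m] [DecidableEq m] in
/-- Underlying matrix of `ŝ(g)`. -/
@[simp] theorem coe_cmUnit (g : Matrix.specialUnitaryGroup n ℂ) :
    (↑(cmUnit e R g) : Matrix (Fin 2) (Fin 2) ℂ) = quatUnit (cmQuat e R g) := rfl

/-- **The engine's Cabibbo–Marinari over-relaxation hit** in the frame `e`: `g ↦ φ((ŝ⁻¹)²) · g`
(`ŝ⁻¹ = ŝ†`; the identity when the block projection vanishes, since then `ŝ = 1`). -/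
noncomputable def cmOR (g : Matrix.specialUnitaryGroup n ℂ) : Matrix.specialUnitaryGroup n ℂ :=
  blockEmbSU e ((cmUnit e R g)⁻¹ * (cmUnit e R g)⁻¹) * g

/-- The embedding `SU(2) →* SU(n)` is continuous. -/
theorem continuous_blockEmbSU : Continuous (blockEmbSU e) :=
  Continuous.subtype_mk ((continuous_blockEmb e).comp continuous_subtype_val) _

omit [Fintype m] [DecidableEq m] in
/-- Off the null set `{|Q(g)|² = 0}` the unit `ŝ(g)` depends continuously on the link. -/
theorem continuousOn_cmUnit :
    ContinuousOn (cmUnit e R) {g | IsQuat.normSq (cmQuat e R g) ≠ 0} := by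
  rw [Topology.IsInducing.subtypeVal.continuousOn_iff]
  have hk : Continuous fun g : Matrix.specialUnitaryGroup n ℂ =>
      ((Real.sqrt (IsQuat.normSq (cmQuat e R g)) : ℝ) : ℂ) :=
    Complex.continuous_ofReal.comp ((continuous_normSq.comp (continuous_cmQuat e R)).sqrt)
  have hcont : ContinuousOn (fun g : Matrix.specialUnitaryGroup n ℂ =>
      (((Real.sqrt (IsQuat.normSq (cmQuat e R g))) : ℝ) : ℂ)⁻¹ • cmQuat e R g)
      {g | IsQuat.normSq (cmQuat e R g) ≠ 0} :=
    (hk.continuousOn.inv₀ fun g hg => Complex.ofReal_ne_zero.mpr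
      (Real.sqrt_pos.mpr (lt_of_le_of_ne (IsQuat.normSq_nonneg _) (Ne.symm hg))).ne').smul
      (continuous_cmQuat e R).continuousOn
  refine hcont.congr fun g hg => ?_
  change quatUnit (cmQuat e R g) = _
  rw [quatUnit, if_neg hg, Complex.ofReal_inv]

omit [Fintype m] [DecidableEq m] in
/-- The null set `{|Q(g)|² = 0}` is measurable (closed). -/
theorem measurableSet_cmNull : MeasurableSet {g | IsQuat.normSq (cmQuat e R g) = 0} :=
  (isClosed_eq (continuous_normSq.comp (continuous_cmQuat e R)) continuous_const).measurableSet

/-! ## §2 The move on a coset: a reflection of SU(2) -/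

/-- On a null coset (`|Q(g)|² = 0`) the unit is `1` all along the coset … -/
theorem cmUnit_blockEmb_mul_of_eq_zero {g : Matrix.specialUnitaryGroup n ℂ}
    (h0 : IsQuat.normSq (cmQuat e R g) = 0) (A : Matrix.specialUnitaryGroup (Fin 2) ℂ) :
    cmUnit e R (blockEmbSU e A * g) = 1 :=
  Subtype.ext (by
    rw [coe_cmUnit, cmQuat_blockEmb_mul, quatUnit_quat_mul_of_eq_zero A.2 (isQuat_cmQuat e R g) h0]
    rfl)

/-- … so the hit is the identity there. -/
theorem cmOR_blockEmb_mul_of_eq_zero {g : Matrix.specialUnitaryGroup n ℂ}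
    (h0 : IsQuat.normSq (cmQuat e R g) = 0) (A : Matrix.specialUnitaryGroup (Fin 2) ℂ) :
    cmOR e R (blockEmbSU e A * g) = blockEmbSU e A * g := by
  rw [cmOR, cmUnit_blockEmb_mul_of_eq_zero e R h0, inv_one, mul_one, map_one, one_mul]

/-- Off the null cosets the unit is equivariant: `ŝ(φ(A) g) = A ŝ(g)` … -/
theorem cmUnit_blockEmb_mul {g : Matrix.specialUnitaryGroup n ℂ}
    (h0 : IsQuat.normSq (cmQuat e R g) ≠ 0) (A : Matrix.specialUnitaryGroup (Fin 2) ℂ) :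
    cmUnit e R (blockEmbSU e A * g) = A * cmUnit e R g :=
  Subtype.ext (by
    rw [coe_cmUnit, cmQuat_blockEmb_mul, quatUnit_quat_mul A.2 (isQuat_cmQuat e R g) h0,
      Submonoid.coe_mul, coe_cmUnit])

/-- … **so along the coset the hit is the reflection `A ↦ s A⁻¹ s` of SU(2)**, `s = ŝ(g)⁻¹`:
`cmOR (φ(A) g) = φ(s A⁻¹ s) g`. -/
theorem cmOR_blockEmb_mul {g : Matrix.specialUnitaryGroup n ℂ}
    (h0 : IsQuat.normSq (cmQuat e R g) ≠ 0) (A : Matrix.specialUnitaryGroup (Fin 2) ℂ) :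
    cmOR e R (blockEmbSU e A * g)
      = blockEmbSU e ((cmUnit e R g)⁻¹ * A⁻¹ * (cmUnit e R g)⁻¹) * g := by
  rw [cmOR, cmUnit_blockEmb_mul e R h0, ← mul_assoc, ← map_mul]
  congr 2
  group

/-- **The OR hit is an involution.** -/
theorem cmOR_involutive : Function.Involutive (cmOR e R) := by
  intro g
  by_cases h0 : IsQuat.normSq (cmQuat e R g) = 0
  · have h1 : cmOR e R g = g := by
      have := cmOR_blockEmb_mul_of_eq_zero e R h0 1
      rwa [map_one, one_mul] at this
    rw [h1, h1]
  · show cmOR e R (blockEmbSU e ((cmUnit e R g)⁻¹ * (cmUnit e R g)⁻¹) * g) = g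
    rw [cmOR_blockEmb_mul e R h0]
    have : (cmUnit e R g)⁻¹ * ((cmUnit e R g)⁻¹ * (cmUnit e R g)⁻¹)⁻¹ * (cmUnit e R g)⁻¹ = 1 := by group
    rw [this, map_one, one_mul]

/-- **The OR hit is measurable**: the identity on the (closed) null set, continuous off it. -/
theorem measurable_cmOR : Measurable (cmOR e R) := by
  classical
  set S := {g : Matrix.specialUnitaryGroup n ℂ | IsQuat.normSq (cmQuat e R g) = 0} with hS
  have hid : ∀ g ∈ S, cmOR e R g = g := fun g hg => by
    have := cmOR_blockEmb_mul_of_eq_zero e R hg 1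
    rwa [map_one, one_mul] at this
  have hpw : cmOR e R = S.piecewise id (cmOR e R) := by
    funext g
    by_cases hg : g ∈ S
    · rw [Set.piecewise_eq_of_mem _ _ _ hg, hid g hg]; rfl
    · rw [Set.piecewise_eq_of_notMem _ _ _ hg]
  have hon : ContinuousOn (cmOR e R) Sᶜ := by
    have hu : ContinuousOn (cmUnit e R) Sᶜ := continuousOn_cmUnit e R
    exact ((continuous_blockEmbSU e).comp_continuousOn ((hu.inv).mul hu.inv)).mul continuousOn_id
  rw [hpw]
  exact continuousOn_id.measurable_piecewise hon (measurableSet_cmNull e R)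

/-! ## §3 Haar measure on `SU(n)` is preserved -/

/-- Coset average: for every `g` and measurable `f ≥ 0`,
`∫ f (cmOR (φ(h) g)) dη(h) = ∫ f (φ(h) g) dη(h)`, `η` the Haar probability of SU(2)
(on a null coset trivially; otherwise `η` is invariant under the reflection `h ↦ s h⁻¹ s`). -/
theorem lintegral_cmOR_coset (g : Matrix.specialUnitaryGroup n ℂ)
    {f : Matrix.specialUnitaryGroup n ℂ → ℝ≥0∞} (hf : Measurable f) :
    ∫⁻ h, f (cmOR e R (blockEmbSU e h * g))
        ∂(Literature.MathematicalPhysics.QuantumFieldTheory.haarProbability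
          (Matrix.specialUnitaryGroup (Fin 2) ℂ))
      = ∫⁻ h, f (blockEmbSU e h * g)
        ∂(Literature.MathematicalPhysics.QuantumFieldTheory.haarProbability
          (Matrix.specialUnitaryGroup (Fin 2) ℂ)) := by
  by_cases h0 : IsQuat.normSq (cmQuat e R g) = 0
  · simp_rw [cmOR_blockEmb_mul_of_eq_zero e R h0]
  · simp_rw [cmOR_blockEmb_mul e R h0]
    have hF : Measurable fun h : Matrix.specialUnitaryGroup (Fin 2) ℂ => f (blockEmbSU e h * g) :=
      hf.comp ((measurable_blockEmbSU e).mul_const g)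
    exact (haar_measurePreserving_reflectThrough ((cmUnit e R g)⁻¹)).lintegral_comp hF

/-- **The OR hit preserves Haar measure on `SU(n)`**: `∫ f ∘ cmOR dμ = ∫ f dμ` for measurable `f ≥ 0`. -/
theorem lintegral_cmOR {f : Matrix.specialUnitaryGroup n ℂ → ℝ≥0∞} (hf : Measurable f) :
    ∫⁻ g, f (cmOR e R g) ∂(Literature.MathematicalPhysics.QuantumFieldTheory.haarProbability
        (Matrix.specialUnitaryGroup n ℂ))
      = ∫⁻ g, f g ∂(Literature.MathematicalPhysics.QuantumFieldTheory.haarProbability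
        (Matrix.specialUnitaryGroup n ℂ)) := by
  set μ := Literature.MathematicalPhysics.QuantumFieldTheory.haarProbability
    (Matrix.specialUnitaryGroup n ℂ)
  set η := Literature.MathematicalPhysics.QuantumFieldTheory.haarProbability
    (Matrix.specialUnitaryGroup (Fin 2) ℂ)
  have hT : Measurable (cmOR e R) := measurable_cmOR e R
  have hφ : Measurable (blockEmbSU e) := measurable_blockEmbSU e
  -- insert the coset average (left invariance of μ, η a probability)
  have h1 : ∀ h : Matrix.specialUnitaryGroup (Fin 2) ℂ,
      ∫⁻ g, f (cmOR e R (blockEmbSU e h * g)) ∂μ = ∫⁻ g, f (cmOR e R g) ∂μ :=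
    fun h => lintegral_mul_left_eq_self (μ := μ) (fun g => f (cmOR e R g)) (blockEmbSU e h)
  have h2 : ∀ h : Matrix.specialUnitaryGroup (Fin 2) ℂ,
      ∫⁻ g, f (blockEmbSU e h * g) ∂μ = ∫⁻ g, f g ∂μ :=
    fun h => lintegral_mul_left_eq_self (μ := μ) f (blockEmbSU e h)
  have hmeas1 : Measurable (Function.uncurry fun (h : Matrix.specialUnitaryGroup (Fin 2) ℂ)
      (g : Matrix.specialUnitaryGroup n ℂ) => f (cmOR e R (blockEmbSU e h * g))) :=
    hf.comp (hT.comp ((hφ.comp measurable_fst).mul measurable_snd))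
  have hmeas2 : Measurable (Function.uncurry fun (h : Matrix.specialUnitaryGroup (Fin 2) ℂ)
      (g : Matrix.specialUnitaryGroup n ℂ) => f (blockEmbSU e h * g)) :=
    hf.comp ((hφ.comp measurable_fst).mul measurable_snd)
  calc ∫⁻ g, f (cmOR e R g) ∂μ
      = ∫⁻ _h, ∫⁻ g, f (cmOR e R g) ∂μ ∂η := by rw [lintegral_const, measure_univ, mul_one]
    _ = ∫⁻ h, ∫⁻ g, f (cmOR e R (blockEmbSU e h * g)) ∂μ ∂η := by simp_rw [h1]
    _ = ∫⁻ g, ∫⁻ h, f (cmOR e R (blockEmbSU e h * g)) ∂η ∂μ :=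
        lintegral_lintegral_swap hmeas1.aemeasurable
    _ = ∫⁻ g, ∫⁻ h, f (blockEmbSU e h * g) ∂η ∂μ :=
        lintegral_congr fun g => lintegral_cmOR_coset e R g hf
    _ = ∫⁻ h, ∫⁻ g, f (blockEmbSU e h * g) ∂μ ∂η :=
        (lintegral_lintegral_swap hmeas2.aemeasurable).symm
    _ = ∫⁻ _h, ∫⁻ g, f g ∂μ ∂η := by simp_rw [h2]
    _ = ∫⁻ g, f g ∂μ := by rw [lintegral_const, measure_univ, mul_one]

/-- **`cmOR` is a measure-preserving map of `(SU(n), Haar)`.** -/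
theorem measurePreserving_cmOR :
    MeasurePreserving (cmOR e R)
      (Literature.MathematicalPhysics.QuantumFieldTheory.haarProbability (Matrix.specialUnitaryGroup n ℂ))
      (Literature.MathematicalPhysics.QuantumFieldTheory.haarProbability (Matrix.specialUnitaryGroup n ℂ)) := by
  refine ⟨measurable_cmOR e R, Measure.ext fun B hB => ?_⟩
  rw [Measure.map_apply (measurable_cmOR e R) hB, ← lintegral_indicator_one hB,
    ← lintegral_indicator_one (measurable_cmOR e R hB)]
  have h : ∀ g, (cmOR e R ⁻¹' B).indicator (1 : Matrix.specialUnitaryGroup n ℂ → ℝ≥0∞) g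
      = B.indicator 1 (cmOR e R g) := fun g => by
    by_cases hg : cmOR e R g ∈ B
    · rw [Set.indicator_of_mem hg, Set.indicator_of_mem (Set.mem_preimage.mpr hg)]; rfl
    · rw [Set.indicator_of_notMem hg, Set.indicator_of_notMem (fun h => hg (Set.mem_preimage.mp h))]
  simp_rw [h]
  exact lintegral_cmOR e R ((measurable_one.indicator hB))

/-! ## §4 The one-link action is conserved -/

/-- **The OR hit conserves the one-link Wilson weight**: `linkWeight c R (cmOR g) = linkWeight c R g`. -/
theorem linkWeight_cmOR (c : ℝ) (g : Matrix.specialUnitaryGroup n ℂ) :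
    linkWeight c R (cmOR e R g) = linkWeight c R g := by
  by_cases h0 : IsQuat.normSq (cmQuat e R g) = 0
  · have := cmOR_blockEmb_mul_of_eq_zero e R h0 1
    rw [map_one, one_mul] at this
    rw [this]
  · -- both weights through `re_trace_blockEmb_mul` and the quaternionic projection
    have key : ∀ A : Matrix.specialUnitaryGroup (Fin 2) ℂ,
        (((↑(blockEmbSU e A * g) : Matrix n n ℂ) * R).trace).re
          = (1 / 2 : ℝ) * (((A : Matrix (Fin 2) (Fin 2) ℂ) * cmQuat e R g).trace).re
            + (((((g : Matrix n n ℂ) * R).submatrix e.symm e.symm).toBlocks₂₂).trace).re := by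
      intro A
      rw [Submonoid.coe_mul, coe_blockEmbSU, Matrix.mul_assoc, re_trace_blockEmb_mul, cmQuat,
        ← (IsQuat.of_mem_specialUnitaryGroup A.2).two_mul_re_trace_mul]
      ring
    have hg : g = blockEmbSU e 1 * g := by rw [map_one, one_mul]
    unfold linkWeight
    rw [cmOR, key]
    conv_rhs => rw [hg, key]
    congr 4
    -- Re tr ((ŝ⁻¹)² Q) = Re tr Q with Q = k ŝ
    set u := cmUnit e R g with hu
    have hQ : cmQuat e R g = ((Real.sqrt (IsQuat.normSq (cmQuat e R g)) : ℝ) : ℂ) • (u : Matrix (Fin 2) (Fin 2) ℂ) := by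
      rw [hu, coe_cmUnit, quatUnit_smul (isQuat_cmQuat e R g)]
    have huu : (↑(u⁻¹) : Matrix (Fin 2) (Fin 2) ℂ) * (u : Matrix (Fin 2) (Fin 2) ℂ) = 1 := by
      rw [← Submonoid.coe_mul, inv_mul_cancel]; rfl
    rw [hQ, Matrix.mul_smul, Matrix.mul_smul, Matrix.trace_smul, Matrix.trace_smul, Submonoid.coe_mul,
      Matrix.mul_assoc, huu, Matrix.mul_one, OneMemClass.coe_one, Matrix.one_mul,
      ← Matrix.star_eq_inv, Matrix.specialUnitaryGroup.coe_star, Matrix.star_eq_conjTranspose,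
      smul_eq_mul, smul_eq_mul, Complex.re_ofReal_mul, Complex.re_ofReal_mul, re_trace_conjTranspose]

/-! ## §5 Exactness of the OR hit -/

/-- **The Cabibbo–Marinari over-relaxation hit is exact**: as a deterministic kernel it is reversible
for the one-link Wilson law `e^{c Re tr (g R)} · Haar_SU(n)` — every frame `e`, real `c`, staple `R`. -/
theorem cmOR_isReversible (c : ℝ) :
    Kernel.IsReversible (Kernel.deterministic (cmOR e R) (measurable_cmOR e R))
      ((Literature.MathematicalPhysics.QuantumFieldTheory.haarProbability
        (Matrix.specialUnitaryGroup n ℂ)).withDensity (linkWeight c R)) := by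
  have hH : Measurable fun g : Matrix.specialUnitaryGroup n ℂ =>
      -(c * (((g : Matrix n n ℂ) * R).trace).re) :=
    ((Complex.continuous_re.comp ((continuous_subtype_val.matrix_mul continuous_const).matrix_trace)
      ).measurable.const_mul c).neg
  have hw : (linkWeight c R) = fun g : Matrix.specialUnitaryGroup n ℂ =>
      ENNReal.ofReal (Real.exp (-(-(c * (((g : Matrix n n ℂ) * R).trace).re)))) := by
    funext g; rw [neg_neg]; rfl
  rw [hw]
  refine microcanonical_isReversible hH (cmOR_involutive e R) (measurePreserving_cmOR e R) fun g => ?_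
  have h := linkWeight_cmOR e R c g
  unfold linkWeight at h
  have h' := ENNReal.ofReal_eq_ofReal_iff (Real.exp_nonneg _) (Real.exp_nonneg _) |>.mp h
  have h'' := Real.exp_injective h'
  rw [h'']

/-- … hence the one-link Wilson law is invariant under the OR hit. -/
theorem cmOR_invariant (c : ℝ) :
    Kernel.Invariant (Kernel.deterministic (cmOR e R) (measurable_cmOR e R))
      ((Literature.MathematicalPhysics.QuantumFieldTheory.haarProbability
        (Matrix.specialUnitaryGroup n ℂ)).withDensity (linkWeight c R)) :=
  (cmOR_isReversible e R c).invariant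

end OR

end Summit.Ventures.LatticeQCDFlow.Exactness
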